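import Literature.NumberTheory.Rogawski1990.RankOneUnstableRamifiedUnitSimilitudeOnePlace   -- ★ p843591 A-p19 (g23): the one-place package (`e`, `u`, `D_u = diag(1,u)`, LEVEL-FAMILY clause) + level lemmas (`K`, `K(m)`, `K♯`)
import Literature.NumberTheory.Rogawski1990.RankOneUnstableRamifiedUnitRow                   -- ★ p843646 (this seat): letter-level closed form `2Φ − Σᶠ = Φ(f) − Φ(f ∘ e)`, `…_eq_zero_of_comp_eq`
import HarnessLib

/-!
# (R1-ram, R-1b) THE RAMIFIED UNIT ROWS AT EVERY `diag(1,u)`-STABLE LEVEL: `Φ^κ(t, 𝟙_{C_S × C}) = 0` for `S ∈ {GL₂(𝒪_w), K(m), K♯, …}` — core AND letter currency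
# (Labesse–Langlands 1979 §2 pp. 9–10 «`φ^T(γ, f) = 0` if `L` is ramified»; Rogawski 1990 Lemma 4.9.3)

Topic `NumberTheory/Rogawski1990`; namespace `Literature.NumberTheory.Rogawski1990`.  THEOREMS ONLY (no definition, no instance, no notation, no named fact, no `sorry`).
Cell `pub/hodgecm-mathlib` (D-0151), crux H413 = `stmt-HodgeConjecture-24833`, line «N6nsGerm» stub `stub_N6nsR1LL`; road «R1-ram» (architect A-p16 RULINGS A-14 (c), A-21 (c),
A-23, census v4∕v5: R-1 = F0P3-p02); seat F0P3-p02 (g13); MEMO-R1ram §2 («`Φ^κ(t, 𝟙_K) = Φ^κ(t, 𝟙_{K_j}) = Φ^κ(t, 𝟙_{K_e}) = 0` at a ramified `v`, for ANY `Ad_h`-invariant `f`»).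
HONEST LABEL: HC_CM is proved only modulo the printed citations (the 2 remaining named inputs hLiu418, h413) until rung 0 closes; this file is the family of UNIT ROWS (level
indicators) of the ramified letter — not the letter for a general `f ∈ C_c^∞(H_v)` (R-5b).

THE MATHEMATICS.  At a RAMIFIED non-split `w ∣ v`, ★ p843591 `exists_unitSimilitudePartner_onePlace_of_ramified` gives a `σ`-fixed `w`-UNIT non-norm `u` and the partner
`e = (Ad diag(1,u), id)` of `H_v = U(Φ₂)(L⁺_v) × U(Φ₁)(L⁺_v)` with: `e t ∼_st t`, `e t ≁ t` (regular `t` in an elliptic torus), `MeasurePreserving e ν ν` for every Haar `ν`, read at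
`w`: `(e a).1_w = D_u · a.1_w · D_u⁻¹`, `(e a).2 = a.2`, and for EVERY `S ≤ GL₂(L_w)` with `D_u S D_u⁻¹ = S`: `(e a).1_w ∈ S ↔ a.1_w ∈ S`.  Hence the LEVEL SET
`C_S × C := {a ∈ H_v | a.1_w ∈ S ∧ a.2 ∈ C}` (`C ⊆ U(Φ₁)_v` arbitrary) is `e`-stable, its indicator `f_{S,C}` satisfies `f_{S,C} ∘ e = f_{S,C}`, and both readings of the κ-row vanish:
CORE (★ p843548 `rankOneDelta_mul_sub_integral_eq_zero_of_comp_eq`) `Δ(t)·(O_ν(t, f_{S,C}) − O_ν(t′, f_{S,C})) = 0`, LETTER (★ p843646 `two_mul_classOrbitalIntegral_sub_finsum_eq_zero_of_comp_eq`)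
`Δ(t)·(2Φ(⟦t⟧, f_{S,C}; m) − Σᶠ_{st} Φ(·, f_{S,C}; m)) = 0`.  The hypothesis on `S` is stated `u`-free: «`S` is normalised by every `diag(1, x)`, `x ∈ 𝒪_wˣ`» — met by
`GL₂(𝒪_w)` (the edge stabiliser `K`), the valued congruence subgroups `K(m)` (normal in `GL₂(𝒪_w)`), the vertex stabiliser `K♯ = D_η GL₂(𝒪_w) D_η⁻¹` and `D_η K(m) D_η⁻¹`
(diagonal matrices commute; ★ p843591's `conj_glDiagonal_…` family), §3.

* §1 `indicator_levelSet_comp_eq` — `f_{S,C} ∘ e = f_{S,C}` for an abstract `e` matching `S` at `w` and fixing the second coordinate.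
* §2 **`rankOneDelta_mul_sub_integral_levelIndicator_eq_zero_of_ramified`** (CORE row, `(w hw he)`; the `hcore_ram`∕`hcore_tame` tokens) + `exists_core_levelIndicator_of_ramified` (`∃ fC = 0`).
* §3 **`rankOne_letter_lhs_levelIndicator_eq_zero_of_ramified`** (LETTER row: canonical `m` for `(Reg, ν)`, `Reg` conj- and stably closed) + `exists_letter_levelIndicator_of_ramified`.
* §4 the `S`-hypothesis for the named levels: `forall_conj_glDiagonal_one_unit_mem_glInt_iff` (`K`), `…_mem_valuedCongruenceSubgroup_iff` (`K(m)`), `…_mem_map_conj_glDiagonal_iff` (`D_η S D_η⁻¹`).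

## References
* [LabesseLanglands1979] J.-P. Labesse, R. P. Langlands, *L-indistinguishability for SL(2)*, Canad. J. Math. 31 (1979) 726–785: §2, Lemma 2.1, pp. 8–10.
* [Rogawski1990] J. D. Rogawski, *Automorphic Representations of Unitary Groups in Three Variables*, Ann. of Math. Stud. 123 (1990): §4.3 (4.3.1) p. 43, §4.9 Lemma 4.9.3 (4.9.2) p. 56,
  Prop. 4.9.1 (b) p. 55, §12.6 p. 174 (`K`, `K′`, Iwahori).
* [Kottwitz1988] R. E. Kottwitz, *Tamagawa numbers*, Ann. of Math. 127 (1988): §2.  [BushnellHenniart2006] C. Bushnell, G. Henniart, *The Local Langlands Conjecture for GL(2)* (2006): §1.1 (congruence subgroups).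
-/

set_option autoImplicit false

noncomputable section

open Set Filter Topology MeasureTheory Measure NumberField IsDedekindDomain Matrix
open scoped Matrix MatrixGroups

namespace Literature.NumberTheory.Rogawski1990

open Literature.NumberTheory.Automorphic Literature.NumberTheory.Automorphic.UnitaryGroup Literature.NumberTheory.GaloisRepresentations

/-! ## §1 The level set `C_S × C` read at `w` is `e`-stable -/

section LevelSet

variable (L : Type) [Field L] [NumberField L] [IsCMField L] (v : HeightOneSpectrum (𝓞 ↥(maximalRealSubfield L)))
  (w : PlacesOver L v) (hw : IsCMField.complexConj L • w.1 = w.1)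

/-- **`f_{S,C} ∘ e = f_{S,C}`**: if `e : H_v → H_v` matches the level `S ≤ GL₂(L_w)` at `w` on the first coordinate (`(e a).1_w ∈ S ↔ a.1_w ∈ S`) and fixes the second coordinate,
the indicator of `{a | a.1_w ∈ S ∧ a.2 ∈ C}` is `e`-invariant. [cite: LabesseLanglands1979, §2 pp. 9–10] [cite: Kottwitz1988, §2] -/
theorem indicator_levelSet_comp_eq (e : (((cmDatum L 2 (Matrix.of fun i j : Fin 2 => if i.val + j.val + 1 = 2 then (1 : L) else 0)).Local v) × ((cmDatum L 1 (Matrix.of fun i j : Fin 1 => if i.val + j.val + 1 = 1 then (1 : L) else 0)).Local v)) ≃ₜ* (((cmDatum L 2 (Matrix.of fun i j : Fin 2 => if i.val + j.val + 1 = 2 then (1 : L) else 0)).Local v) × ((cmDatum L 1 (Matrix.of fun i j : Fin 1 => if i.val + j.val + 1 = 1 then (1 : L) else 0)).Local v))) (S : Subgroup (GL (Fin 2) (w.1.adicCompletion L))) (C : Set ((cmDatum L 1 (Matrix.of fun i j : Fin 1 => if i.val + j.val + 1 = 1 then (1 : L) else 0)).Local v))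
    (hS : ∀ a : (((cmDatum L 2 (Matrix.of fun i j : Fin 2 => if i.val + j.val + 1 = 2 then (1 : L) else 0)).Local v) × ((cmDatum L 1 (Matrix.of fun i j : Fin 1 => if i.val + j.val + 1 = 1 then (1 : L) else 0)).Local v)), ((localNonsplitEquiv (IsCMField.complexConj L) (Matrix.of fun i j : Fin 2 => if i.val + j.val + 1 = 2 then (1 : L) else 0) (IsCMField.complexConj_ne_one L) w hw (e a).1 : ↥(unitaryGroupOfForm (galAdicCompletionMap (L := L) (IsCMField.complexConj L) hw) (placeForm (Matrix.of fun i j : Fin 2 => if i.val + j.val + 1 = 2 then (1 : L) else 0) w.1))) : GL (Fin 2) (w.1.adicCompletion L)) ∈ S ↔ ((localNonsplitEquiv (IsCMField.complexConj L) (Matrix.of fun i j : Fin 2 => if i.val + j.val + 1 = 2 then (1 : L) else 0) (IsCMField.complexConj_ne_one L) w hw a.1 : ↥(unitaryGroupOfForm (galAdicCompletionMap (L := L) (IsCMField.complexConj L) hw) (placeForm (Matrix.of fun i j : Fin 2 => if i.val + j.val + 1 = 2 then (1 : L) else 0) w.1))) : GL (Fin 2) (w.1.adicCompletion L)) ∈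 S) (h2 : ∀ a : (((cmDatum L 2 (Matrix.of fun i j : Fin 2 => if i.val + j.val + 1 = 2 then (1 : L) else 0)).Local v) × ((cmDatum L 1 (Matrix.of fun i j : Fin 1 => if i.val + j.val + 1 = 1 then (1 : L) else 0)).Local v)), (e a).2 = a.2) :
    ({a : (((cmDatum L 2 (Matrix.of fun i j : Fin 2 => if i.val + j.val + 1 = 2 then (1 : L) else 0)).Local v) × ((cmDatum L 1 (Matrix.of fun i j : Fin 1 => if i.val + j.val + 1 = 1 then (1 : L) else 0)).Local v)) | ((localNonsplitEquiv (IsCMField.complexConj L) (Matrix.of fun i j : Fin 2 => if i.val + j.val + 1 = 2 then (1 : L) else 0) (IsCMField.complexConj_ne_one L) w hw a.1 : ↥(unitaryGroupOfForm (galAdicCompletionMap (L := L) (IsCMField.complexConj L) hw) (placeForm (Matrix.of fun i j : Fin 2 => if i.val + j.val + 1 = 2 then (1 : L) else 0) w.1))) : GL (Fin 2) (w.1.adicCompletion L)) ∈ S ∧ a.2 ∈ C}.indicator fun _ => (1 : ℂ)) ∘ e = {a : (((cmDatum L 2 (Matrix.of fun i j : Fin 2 => if i.val + j.val + 1 = 2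 then (1 : L) else 0)).Local v) × ((cmDatum L 1 (Matrix.of fun i j : Fin 1 => if i.val + j.val + 1 = 1 then (1 : L) else 0)).Local v)) | ((localNonsplitEquiv (IsCMField.complexConj L) (Matrix.of fun i j : Fin 2 => if i.val + j.val + 1 = 2 then (1 : L) else 0) (IsCMField.complexConj_ne_one L) w hw a.1 : ↥(unitaryGroupOfForm (galAdicCompletionMap (L := L) (IsCMField.complexConj L) hw) (placeForm (Matrix.of fun i j : Fin 2 => if i.val + j.val + 1 = 2 then (1 : L) else 0) w.1))) : GL (Fin 2) (w.1.adicCompletion L)) ∈ S ∧ a.2 ∈ C}.indicator fun _ => (1 : ℂ) := by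
  funext a
  simp only [Function.comp_apply]
  have hmem : e a ∈ {a : (((cmDatum L 2 (Matrix.of fun i j : Fin 2 => if i.val + j.val + 1 = 2 then (1 : L) else 0)).Local v) × ((cmDatum L 1 (Matrix.of fun i j : Fin 1 => if i.val + j.val + 1 = 1 then (1 : L) else 0)).Local v)) | ((localNonsplitEquiv (IsCMField.complexConj L) (Matrix.of fun i j : Fin 2 => if i.val + j.val + 1 = 2 then (1 : L) else 0) (IsCMField.complexConj_ne_one L) w hw a.1 : ↥(unitaryGroupOfForm (galAdicCompletionMap (L := L) (IsCMField.complexConj L) hw) (placeForm (Matrix.of fun i j : Fin 2 => if i.val + j.val + 1 = 2 then (1 : L) else 0) w.1))) : GL (Fin 2) (w.1.adicCompletion L)) ∈ S ∧ a.2 ∈ C} ↔ a ∈ {a : (((cmDatum L 2 (Matrix.of fun i j : Fin 2 => if i.val + j.val + 1 = 2 then (1 : L) else 0)).Local v) × ((cmDatum L 1 (Matrix.of fun i j : Fin 1 => if i.val + j.val + 1 = 1 then (1 : L) else 0)).Local v)) | ((localNonsplitEquiv (IsCMField.complexConj L) (Matrix.of fun i j : Fin 2 => if i.val + j.val + 1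 = 2 then (1 : L) else 0) (IsCMField.complexConj_ne_one L) w hw a.1 : ↥(unitaryGroupOfForm (galAdicCompletionMap (L := L) (IsCMField.complexConj L) hw) (placeForm (Matrix.of fun i j : Fin 2 => if i.val + j.val + 1 = 2 then (1 : L) else 0) w.1))) : GL (Fin 2) (w.1.adicCompletion L)) ∈ S ∧ a.2 ∈ C} := by
    simp only [Set.mem_setOf_eq, hS a, h2 a]
  by_cases ha : a ∈ {a : (((cmDatum L 2 (Matrix.of fun i j : Fin 2 => if i.val + j.val + 1 = 2 then (1 : L) else 0)).Local v) × ((cmDatum L 1 (Matrix.of fun i j : Fin 1 => if i.val + j.val + 1 = 1 then (1 : L) else 0)).Local v)) | ((localNonsplitEquiv (IsCMField.complexConj L) (Matrix.of fun i j : Fin 2 => if i.val + j.val + 1 = 2 then (1 : L) else 0) (IsCMField.complexConj_ne_one L) w hw a.1 : ↥(unitaryGroupOfForm (galAdicCompletionMap (L := L) (IsCMField.complexConj L) hw) (placeForm (Matrix.of fun i j : Fin 2 => if i.val + j.val + 1 = 2 then (1 : L) else 0) w.1))) : GL (Fin 2) (w.1.adicCompletion L)) ∈ S ∧ a.2 ∈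 C}
  · rw [Set.indicator_of_mem (hmem.2 ha), Set.indicator_of_mem ha]
  · rw [Set.indicator_of_notMem (fun h => ha (hmem.1 h)), Set.indicator_of_notMem ha]

end LevelSet

/-! ## §2 CORE rows: `Δ(t)·(O_ν(t, f_{S,C}) − O_ν(t′, f_{S,C})) = 0` at a ramified place -/

section Core

variable (L : Type) [Field L] [NumberField L] [IsCMField L] (v : HeightOneSpectrum (𝓞 ↥(maximalRealSubfield L)))
  (w : PlacesOver L v) (hw : IsCMField.complexConj L • w.1 = w.1) (he : v.asIdeal.ramificationIdx' w.1.asIdeal ≠ 1)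
  [MeasurableSpace (((cmDatum L 2 (Matrix.of fun i j : Fin 2 => if i.val + j.val + 1 = 2 then (1 : L) else 0)).Local v) × ((cmDatum L 1 (Matrix.of fun i j : Fin 1 => if i.val + j.val + 1 = 1 then (1 : L) else 0)).Local v))] [BorelSpace (((cmDatum L 2 (Matrix.of fun i j : Fin 2 => if i.val + j.val + 1 = 2 then (1 : L) else 0)).Local v) × ((cmDatum L 1 (Matrix.of fun i j : Fin 1 => if i.val + j.val + 1 = 1 then (1 : L) else 0)).Local v))] (ν : Measure (((cmDatum L 2 (Matrix.of fun i j : Fin 2 => if i.val + j.val + 1 = 2 then (1 : L) else 0)).Local v) × ((cmDatum L 1 (Matrix.of fun i j : Fin 1 => if i.val + j.val + 1 = 1 then (1 : L) else 0)).Local v))) [ν.IsHaarMeasure] [ν.IsMulRightInvariant]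

include hw he in
/-- **CORE UNIT ROW AT EVERY `diag(1,·)`-STABLE LEVEL (`hcore_ram`∕`hcore_tame` tokens of ★ `rankOneUnstableTransferNonsplitCMERamified_of_core[_tame_of_wild]`).**  `w ∣ v` conjugation-fixed and
RAMIFIED; `ν` a two-sided Haar measure of `H_v`; `S ≤ GL₂(L_w)` normalised by every `diag(1, x)`, `x ∈ 𝒪_wˣ` (`GL₂(𝒪_w)`, `K(m)`, `K♯`, … — §4); `C ⊆ U(Φ₁)_v` arbitrary; `f_{S,C} = 𝟙_{{a | a.1_w ∈ S ∧ a.2 ∈ C}}`;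
`Z(t₀)` an elliptic torus (`t₀.1` regular, frame `(P, d)` with norm-one eigenvalues); `μ` any Hecke character.  Then for every regular `t ∈ Z(t₀)` and every `t′` stably conjugate and not
conjugate to `t`: **`μ_w(γ₁ − γ₃)⁻¹ · (∏‖γ₁ − γ₃‖)^{1∕2} · (∫ f_{S,C}(y t y⁻¹) dν − ∫ f_{S,C}(y t′ y⁻¹) dν) = 0`** (★ p843591 package: `t′ ∼ e t`, `f_{S,C} ∘ e = f_{S,C}`, `e_* ν = ν`).
[cite: LabesseLanglands1979, §2 pp. 9–10] [cite: Rogawski1990, §4.9 Lemma 4.9.3 (4.9.2) p. 56; §12.6 p. 174] -/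
theorem rankOneDelta_mul_sub_integral_levelIndicator_eq_zero_of_ramified (μ : HeckeCharacter L)
    (S : Subgroup (GL (Fin 2) (w.1.adicCompletion L)))
    (hS : ∀ x : (w.1.adicCompletion L)ˣ, Valued.v (x : w.1.adicCompletion L) = 1 →
      ∀ s, glDiagonal 2 (w.1.adicCompletion L) ![1, x] * s * (glDiagonal 2 (w.1.adicCompletion L) ![1, x])⁻¹ ∈ S ↔ s ∈ S)
    (C : Set ((cmDatum L 1 (Matrix.of fun i j : Fin 1 => if i.val + j.val + 1 = 1 then (1 : L) else 0)).Local v))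
    (t₀ : (((cmDatum L 2 (Matrix.of fun i j : Fin 2 => if i.val + j.val + 1 = 2 then (1 : L) else 0)).Local v) × ((cmDatum L 1 (Matrix.of fun i j : Fin 1 => if i.val + j.val + 1 = 1 then (1 : L) else 0)).Local v))) (P : GL (Fin 2) (LocalRing L v)) (d : Fin 2 → LocalRing L v) (ht₀ : IsRegularElt (t₀.1.val : GL (Fin 2) (LocalRing L v)))
    (hP : (t₀.1.val.val : Matrix (Fin 2) (Fin 2) (LocalRing L v)) * P.val = P.val * Matrix.diagonal d) (hd1 : ∀ i, (conjLocal L (IsCMField.complexConj L) v) (d i) * d i = 1)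
    (t : ↥(Subgroup.centralizer ({t₀} : Set (((cmDatum L 2 (Matrix.of fun i j : Fin 2 => if i.val + j.val + 1 = 2 then (1 : L) else 0)).Local v) × ((cmDatum L 1 (Matrix.of fun i j : Fin 1 => if i.val + j.val + 1 = 1 then (1 : L) else 0)).Local v))))) (ht : IsRegularElt ((t : (((cmDatum L 2 (Matrix.of fun i j : Fin 2 => if i.val + j.val + 1 = 2 then (1 : L) else 0)).Local v) × ((cmDatum L 1 (Matrix.of fun i j : Fin 1 => if i.val + j.val + 1 = 1 then (1 : L) else 0)).Local v))).1.val : GL (Fin 2) (LocalRing L v)))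
    (t' : (((cmDatum L 2 (Matrix.of fun i j : Fin 2 => if i.val + j.val + 1 = 2 then (1 : L) else 0)).Local v) × ((cmDatum L 1 (Matrix.of fun i j : Fin 1 => if i.val + j.val + 1 = 1 then (1 : L) else 0)).Local v))) (hst : IsLocalStablyConjH L v (t : (((cmDatum L 2 (Matrix.of fun i j : Fin 2 => if i.val + j.val + 1 = 2 then (1 : L) else 0)).Local v) × ((cmDatum L 1 (Matrix.of fun i j : Fin 1 => if i.val + j.val + 1 = 1 then (1 : L) else 0)).Local v))) t') (hnc : ¬ IsConj (t : (((cmDatum L 2 (Matrix.of fun i j : Fin 2 => if i.val + j.val + 1 = 2 then (1 : L) else 0)).Local v) × ((cmDatum L 1 (Matrix.of fun i j : Fin 1 => if i.val + j.val + 1 = 1 then (1 : L) else 0)).Local v))) t') :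
    ((finHeckeValue L v μ (((P⁻¹).val * ((t : (((cmDatum L 2 (Matrix.of fun i j : Fin 2 => if i.val + j.val + 1 = 2 then (1 : L) else 0)).Local v) × ((cmDatum L 1 (Matrix.of fun i j : Fin 1 => if i.val + j.val + 1 = 1 then (1 : L) else 0)).Local v))).1.val.val : Matrix (Fin 2) (Fin 2) (LocalRing L v)) * P.val) 0 0 - ((P⁻¹).val * ((t : (((cmDatum L 2 (Matrix.of fun i j : Fin 2 => if i.val + j.val + 1 = 2 then (1 : L) else 0)).Local v) × ((cmDatum L 1 (Matrix.of fun i j : Fin 1 => if i.val + j.val + 1 = 1 then (1 : L) else 0)).Local v))).1.val.val : Matrix (Fin 2) (Fin 2) (LocalRing L v)) * P.val) 1 1))⁻¹ : ℂ) *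
        ((Real.sqrt (∏ w' : PlacesOver L v, ‖(((P⁻¹).val * ((t : (((cmDatum L 2 (Matrix.of fun i j : Fin 2 => if i.val + j.val + 1 = 2 then (1 : L) else 0)).Local v) × ((cmDatum L 1 (Matrix.of fun i j : Fin 1 => if i.val + j.val + 1 = 1 then (1 : L) else 0)).Local v))).1.val.val : Matrix (Fin 2) (Fin 2) (LocalRing L v)) * P.val) 0 0 - ((P⁻¹).val * ((t : (((cmDatum L 2 (Matrix.of fun i j : Fin 2 => if i.val + j.val + 1 = 2 then (1 : L) else 0)).Local v) × ((cmDatum L 1 (Matrix.of fun i j : Fin 1 => if i.val + j.val + 1 = 1 then (1 : L) else 0)).Local v))).1.val.val : Matrix (Fin 2) (Fin 2) (LocalRing L v)) * P.val) 1 1) w'‖) : ℝ) : ℂ) *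
        ((∫ y, ({a : (((cmDatum L 2 (Matrix.of fun i j : Fin 2 => if i.val + j.val + 1 = 2 then (1 : L) else 0)).Local v) × ((cmDatum L 1 (Matrix.of fun i j : Fin 1 => if i.val + j.val + 1 = 1 then (1 : L) else 0)).Local v)) | ((localNonsplitEquiv (IsCMField.complexConj L) (Matrix.of fun i j : Fin 2 => if i.val + j.val + 1 = 2 then (1 : L) else 0) (IsCMField.complexConj_ne_one L) w hw a.1 : ↥(unitaryGroupOfForm (galAdicCompletionMap (L := L) (IsCMField.complexConj L) hw) (placeForm (Matrix.of fun i j : Fin 2 => if i.val + j.val + 1 = 2 then (1 : L) else 0) w.1))) : GL (Fin 2) (w.1.adicCompletion L)) ∈ S ∧ a.2 ∈ C}.indicator (fun _ => (1 : ℂ))) (y * (t : (((cmDatum L 2 (Matrix.of fun i j : Fin 2 => if i.val + j.val + 1 = 2 then (1 : L) else 0)).Local v) × ((cmDatum L 1 (Matrix.of fun i j : Fin 1 => if i.val + j.val + 1 = 1 then (1 : L) else 0)).Local v))) * y⁻¹) ∂ν) -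
          ∫ y, ({a : (((cmDatum L 2 (Matrix.of fun i j : Fin 2 => if i.val + j.val + 1 = 2 then (1 : L) else 0)).Local v) × ((cmDatum L 1 (Matrix.of fun i j : Fin 1 => if i.val + j.val + 1 = 1 then (1 : L) else 0)).Local v)) | ((localNonsplitEquiv (IsCMField.complexConj L) (Matrix.of fun i j : Fin 2 => if i.val + j.val + 1 = 2 then (1 : L) else 0) (IsCMField.complexConj_ne_one L) w hw a.1 : ↥(unitaryGroupOfForm (galAdicCompletionMap (L := L) (IsCMField.complexConj L) hw) (placeForm (Matrix.of fun i j : Fin 2 => if i.val + j.val + 1 = 2 then (1 : L) else 0) w.1))) : GL (Fin 2) (w.1.adicCompletion L)) ∈ S ∧ a.2 ∈ C}.indicator (fun _ => (1 : ℂ))) (y * t' * y⁻¹) ∂ν) = 0 := by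
  obtain ⟨r, hru, u, e, -, -, -, hAd, -, hest, -, hν, -, hvu, -, -, hEw, -, hSall⟩ :=
    exists_unitSimilitudePartner_onePlace_of_ramified L v w hw he t₀ P d ht₀ hP hd1
  have hfix := indicator_levelSet_comp_eq L v w hw e S C (hSall S (hS u hvu)) (fun a => (hAd a).2)
  exact rankOneDelta_mul_sub_integral_eq_zero_of_comp_eq L v w hw μ ν e (hν ν) _ hfix t₀ P d ht₀ hP hd1 t ht (hest t ht) t' hst hnc

include hw he in
/-- **… in the `∃ fC` shape of `hcore_ram` (★ p843417) ∕ `hcore_tame` (★ p843709) at `f = f_{S,C}`, with `fC = 0`** (locally constant).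
[cite: LabesseLanglands1979, §2 pp. 9–10] [cite: Rogawski1990, §4.9 Lemma 4.9.3 (4.9.2) p. 56] -/
theorem exists_core_levelIndicator_of_ramified (μ : HeckeCharacter L)
    (S : Subgroup (GL (Fin 2) (w.1.adicCompletion L)))
    (hS : ∀ x : (w.1.adicCompletion L)ˣ, Valued.v (x : w.1.adicCompletion L) = 1 →
      ∀ s, glDiagonal 2 (w.1.adicCompletion L) ![1, x] * s * (glDiagonal 2 (w.1.adicCompletion L) ![1, x])⁻¹ ∈ S ↔ s ∈ S)
    (C : Set ((cmDatum L 1 (Matrix.of fun i j : Fin 1 => if i.val + j.val + 1 = 1 then (1 : L) else 0)).Local v))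
    (t₀ : (((cmDatum L 2 (Matrix.of fun i j : Fin 2 => if i.val + j.val + 1 = 2 then (1 : L) else 0)).Local v) × ((cmDatum L 1 (Matrix.of fun i j : Fin 1 => if i.val + j.val + 1 = 1 then (1 : L) else 0)).Local v))) (P : GL (Fin 2) (LocalRing L v)) (d : Fin 2 → LocalRing L v) (ht₀ : IsRegularElt (t₀.1.val : GL (Fin 2) (LocalRing L v)))
    (hP : (t₀.1.val.val : Matrix (Fin 2) (Fin 2) (LocalRing L v)) * P.val = P.val * Matrix.diagonal d) (hd1 : ∀ i, (conjLocal L (IsCMField.complexConj L) v) (d i) * d i = 1) :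
    ∃ fC : ↥(Subgroup.centralizer ({t₀} : Set (((cmDatum L 2 (Matrix.of fun i j : Fin 2 => if i.val + j.val + 1 = 2 then (1 : L) else 0)).Local v) × ((cmDatum L 1 (Matrix.of fun i j : Fin 1 => if i.val + j.val + 1 = 1 then (1 : L) else 0)).Local v)))) → ℂ, IsLocallyConstant fC ∧
      ∀ t : ↥(Subgroup.centralizer ({t₀} : Set (((cmDatum L 2 (Matrix.of fun i j : Fin 2 => if i.val + j.val + 1 = 2 then (1 : L) else 0)).Local v) × ((cmDatum L 1 (Matrix.of fun i j : Fin 1 => if i.val + j.val + 1 = 1 then (1 : L) else 0)).Local v)))), IsRegularElt ((t : (((cmDatum L 2 (Matrix.of fun i j : Fin 2 => if i.val + j.val + 1 = 2 then (1 : L) else 0)).Local v) × ((cmDatum L 1 (Matrix.of fun i j : Fin 1 => if i.val + j.val + 1 = 1 then (1 : L) else 0)).Local v))).1.val : GL (Fin 2) (LocalRing L v)) → ∀ t' : (((cmDatum L 2 (Matrix.of fun i j : Fin 2 => if i.val + j.val + 1 = 2 then (1 : L) else 0)).Local v) × ((cmDatum L 1 (Matrix.of fun i j : Fin 1 => if i.val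 + j.val + 1 = 1 then (1 : L) else 0)).Local v)),
        IsLocalStablyConjH L v (t : (((cmDatum L 2 (Matrix.of fun i j : Fin 2 => if i.val + j.val + 1 = 2 then (1 : L) else 0)).Local v) × ((cmDatum L 1 (Matrix.of fun i j : Fin 1 => if i.val + j.val + 1 = 1 then (1 : L) else 0)).Local v))) t' → ¬ IsConj (t : (((cmDatum L 2 (Matrix.of fun i j : Fin 2 => if i.val + j.val + 1 = 2 then (1 : L) else 0)).Local v) × ((cmDatum L 1 (Matrix.of fun i j : Fin 1 => if i.val + j.val + 1 = 1 then (1 : L) else 0)).Local v))) t' →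
        ((finHeckeValue L v μ (((P⁻¹).val * ((t : (((cmDatum L 2 (Matrix.of fun i j : Fin 2 => if i.val + j.val + 1 = 2 then (1 : L) else 0)).Local v) × ((cmDatum L 1 (Matrix.of fun i j : Fin 1 => if i.val + j.val + 1 = 1 then (1 : L) else 0)).Local v))).1.val.val : Matrix (Fin 2) (Fin 2) (LocalRing L v)) * P.val) 0 0 - ((P⁻¹).val * ((t : (((cmDatum L 2 (Matrix.of fun i j : Fin 2 => if i.val + j.val + 1 = 2 then (1 : L) else 0)).Local v) × ((cmDatum L 1 (Matrix.of fun i j : Fin 1 => if i.val + j.val + 1 = 1 then (1 : L) else 0)).Local v))).1.val.val : Matrix (Fin 2) (Fin 2) (LocalRing L v)) * P.val) 1 1))⁻¹ : ℂ) *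
            ((Real.sqrt (∏ w' : PlacesOver L v, ‖(((P⁻¹).val * ((t : (((cmDatum L 2 (Matrix.of fun i j : Fin 2 => if i.val + j.val + 1 = 2 then (1 : L) else 0)).Local v) × ((cmDatum L 1 (Matrix.of fun i j : Fin 1 => if i.val + j.val + 1 = 1 then (1 : L) else 0)).Local v))).1.val.val : Matrix (Fin 2) (Fin 2) (LocalRing L v)) * P.val) 0 0 - ((P⁻¹).val * ((t : (((cmDatum L 2 (Matrix.of fun i j : Fin 2 => if i.val + j.val + 1 = 2 then (1 : L) else 0)).Local v) × ((cmDatum L 1 (Matrix.of fun i j : Fin 1 => if i.val + j.val + 1 = 1 then (1 : L) else 0)).Local v))).1.val.val : Matrix (Fin 2) (Fin 2) (LocalRing L v)) * P.val) 1 1) w'‖) : ℝ) : ℂ) *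
            ((∫ y, ({a : (((cmDatum L 2 (Matrix.of fun i j : Fin 2 => if i.val + j.val + 1 = 2 then (1 : L) else 0)).Local v) × ((cmDatum L 1 (Matrix.of fun i j : Fin 1 => if i.val + j.val + 1 = 1 then (1 : L) else 0)).Local v)) | ((localNonsplitEquiv (IsCMField.complexConj L) (Matrix.of fun i j : Fin 2 => if i.val + j.val + 1 = 2 then (1 : L) else 0) (IsCMField.complexConj_ne_one L) w hw a.1 : ↥(unitaryGroupOfForm (galAdicCompletionMap (L := L) (IsCMField.complexConj L) hw) (placeForm (Matrix.of fun i j : Fin 2 => if i.val + j.val + 1 = 2 then (1 : L) else 0) w.1))) : GL (Fin 2) (w.1.adicCompletion L)) ∈ S ∧ a.2 ∈ C}.indicator (fun _ => (1 : ℂ))) (y * (t : (((cmDatum L 2 (Matrix.of fun i j : Fin 2 => if i.val + j.val + 1 = 2 then (1 : L) else 0)).Local v) × ((cmDatum L 1 (Matrix.of fun i j : Fin 1 => if i.val + j.val + 1 = 1 then (1 : L) else 0)).Local v))) * y⁻¹) ∂ν) -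
              ∫ y, ({a : (((cmDatum L 2 (Matrix.of fun i j : Fin 2 => if i.val + j.val + 1 = 2 then (1 : L) else 0)).Local v) × ((cmDatum L 1 (Matrix.of fun i j : Fin 1 => if i.val + j.val + 1 = 1 then (1 : L) else 0)).Local v)) | ((localNonsplitEquiv (IsCMField.complexConj L) (Matrix.of fun i j : Fin 2 => if i.val + j.val + 1 = 2 then (1 : L) else 0) (IsCMField.complexConj_ne_one L) w hw a.1 : ↥(unitaryGroupOfForm (galAdicCompletionMap (L := L) (IsCMField.complexConj L) hw) (placeForm (Matrix.of fun i j : Fin 2 => if i.val + j.val + 1 = 2 then (1 : L) else 0) w.1))) : GL (Fin 2) (w.1.adicCompletion L)) ∈ S ∧ a.2 ∈ C}.indicator (fun _ => (1 : ℂ))) (y * t' * y⁻¹) ∂ν) = fC t :=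
  ⟨fun _ => 0, IsLocallyConstant.const 0, fun t ht t' hst hnc =>
    rankOneDelta_mul_sub_integral_levelIndicator_eq_zero_of_ramified L v w hw he ν μ S hS C t₀ P d ht₀ hP hd1 t ht t' hst hnc⟩

end Core

/-! ## §3 LETTER rows: `Δ(t)·(2Φ(⟦t⟧, f_{S,C}; m) − Σᶠ_{st} Φ(·, f_{S,C}; m)) = 0` at a ramified place -/

section Letter

variable (L : Type) [Field L] [NumberField L] [IsCMField L] (v : HeightOneSpectrum (𝓞 ↥(maximalRealSubfield L)))
  (w : PlacesOver L v) (hw : IsCMField.complexConj L • w.1 = w.1) (he : v.asIdeal.ramificationIdx' w.1.asIdeal ≠ 1)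
  [MeasurableSpace (((cmDatum L 2 (Matrix.of fun i j : Fin 2 => if i.val + j.val + 1 = 2 then (1 : L) else 0)).Local v) × ((cmDatum L 1 (Matrix.of fun i j : Fin 1 => if i.val + j.val + 1 = 1 then (1 : L) else 0)).Local v))] [BorelSpace (((cmDatum L 2 (Matrix.of fun i j : Fin 2 => if i.val + j.val + 1 = 2 then (1 : L) else 0)).Local v) × ((cmDatum L 1 (Matrix.of fun i j : Fin 1 => if i.val + j.val + 1 = 1 then (1 : L) else 0)).Local v))] (ν : Measure (((cmDatum L 2 (Matrix.of fun i j : Fin 2 => if i.val + j.val + 1 = 2 then (1 : L) else 0)).Local v) × ((cmDatum L 1 (Matrix.of fun i j : Fin 1 => if i.val + j.val + 1 = 1 then (1 : L) else 0)).Local v))) [ν.IsHaarMeasure] [ν.IsMulRightInvariant]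
  [iZ : ∀ γ : (((cmDatum L 2 (Matrix.of fun i j : Fin 2 => if i.val + j.val + 1 = 2 then (1 : L) else 0)).Local v) × ((cmDatum L 1 (Matrix.of fun i j : Fin 1 => if i.val + j.val + 1 = 1 then (1 : L) else 0)).Local v)), MeasurableSpace ((((cmDatum L 2 (Matrix.of fun i j : Fin 2 => if i.val + j.val + 1 = 2 then (1 : L) else 0)).Local v) × ((cmDatum L 1 (Matrix.of fun i j : Fin 1 => if i.val + j.val + 1 = 1 then (1 : L) else 0)).Local v)) ⧸ Subgroup.centralizer ({γ} : Set (((cmDatum L 2 (Matrix.of fun i j : Fin 2 => if i.val + j.val + 1 = 2 then (1 : L) else 0)).Local v) × ((cmDatum L 1 (Matrix.of fun i j : Fin 1 => if i.val + j.val + 1 = 1 then (1 : L) else 0)).Local v))))]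
  [bZ : ∀ γ : (((cmDatum L 2 (Matrix.of fun i j : Fin 2 => if i.val + j.val + 1 = 2 then (1 : L) else 0)).Local v) × ((cmDatum L 1 (Matrix.of fun i j : Fin 1 => if i.val + j.val + 1 = 1 then (1 : L) else 0)).Local v)), BorelSpace ((((cmDatum L 2 (Matrix.of fun i j : Fin 2 => if i.val + j.val + 1 = 2 then (1 : L) else 0)).Local v) × ((cmDatum L 1 (Matrix.of fun i j : Fin 1 => if i.val + j.val + 1 = 1 then (1 : L) else 0)).Local v)) ⧸ Subgroup.centralizer ({γ} : Set (((cmDatum L 2 (Matrix.of fun i j : Fin 2 => if i.val + j.val + 1 = 2 then (1 : L) else 0)).Local v) × ((cmDatum L 1 (Matrix.of fun i j : Fin 1 => if i.val + j.val + 1 = 1 then (1 : L) else 0)).Local v))))]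

include hw he in
/-- **LETTER UNIT ROW AT EVERY `diag(1,·)`-STABLE LEVEL.**  With the letter's data — `Reg` a conjugation- and STABLY-closed sub-predicate of «`U(Φ₂)`-part regular», `m` an orbital-measure
family CANONICAL for `(Reg, ν)` — and `S`, `C`, `f_{S,C}`, `Z(t₀)`, `μ` as in §2: for every `t ∈ Z(t₀)` with `Reg t`,
**`μ_w(γ₁ − γ₃)⁻¹ · (∏‖γ₁ − γ₃‖)^{1∕2} · (2Φ(⟦t⟧, f_{S,C}; m) − Σᶠ_{d ∼_st t} Φ(d, f_{S,C}; m)) = 0`** — «`φ^T(γ, 𝟙) = 0` if `L` is ramified» for `K`, `K(m)`, `K♯`, … in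
Rogawski's canonical normalisation (★ p843646 closed form `2Φ − Σᶠ = Φ(f) − Φ(f ∘ e)`; compare the INERT certificate ★ `rankOne_lhs_indicator_eq_of_eigenframe_of_guard` ≠ 0).
[cite: LabesseLanglands1979, §2 pp. 9–10] [cite: Rogawski1990, §4.9 Lemma 4.9.3 (4.9.2) p. 56; §4.3 (4.3.1) p. 43; §12.6 p. 174] -/
theorem rankOne_letter_lhs_levelIndicator_eq_zero_of_ramified (μ : HeckeCharacter L)
    {m : OrbitalMeasureFamily (((cmDatum L 2 (Matrix.of fun i j : Fin 2 => if i.val + j.val + 1 = 2 then (1 : L) else 0)).Local v) × ((cmDatum L 1 (Matrix.of fun i j : Fin 1 => if i.val + j.val + 1 = 1 then (1 : L) else 0)).Local v))} {Reg : (((cmDatum L 2 (Matrix.of fun i j : Fin 2 => if i.val + j.val + 1 = 2 then (1 : L) else 0)).Local v) × ((cmDatum L 1 (Matrix.of fun i j : Fin 1 => if i.val + j.val + 1 = 1 then (1 : L) else 0)).Local v)) → Prop} (hReg : ∀ γ, Reg γ → IsRegularElt (γ.1.val : GL (Fin 2) (LocalRing L v)))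
    (hconj : ∀ γ x, Reg γ → Reg (x * γ * x⁻¹)) (hstab : ∀ γ δ, Reg γ → IsLocalStablyConjH L v γ δ → Reg δ) (hm : m.IsCanonical Reg ν)
    (S : Subgroup (GL (Fin 2) (w.1.adicCompletion L)))
    (hS : ∀ x : (w.1.adicCompletion L)ˣ, Valued.v (x : w.1.adicCompletion L) = 1 →
      ∀ s, glDiagonal 2 (w.1.adicCompletion L) ![1, x] * s * (glDiagonal 2 (w.1.adicCompletion L) ![1, x])⁻¹ ∈ S ↔ s ∈ S)
    (C : Set ((cmDatum L 1 (Matrix.of fun i j : Fin 1 => if i.val + j.val + 1 = 1 then (1 : L) else 0)).Local v))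
    (t₀ : (((cmDatum L 2 (Matrix.of fun i j : Fin 2 => if i.val + j.val + 1 = 2 then (1 : L) else 0)).Local v) × ((cmDatum L 1 (Matrix.of fun i j : Fin 1 => if i.val + j.val + 1 = 1 then (1 : L) else 0)).Local v))) (P : GL (Fin 2) (LocalRing L v)) (d : Fin 2 → LocalRing L v) (ht₀ : IsRegularElt (t₀.1.val : GL (Fin 2) (LocalRing L v)))
    (hP : (t₀.1.val.val : Matrix (Fin 2) (Fin 2) (LocalRing L v)) * P.val = P.val * Matrix.diagonal d) (hd1 : ∀ i, (conjLocal L (IsCMField.complexConj L) v) (d i) * d i = 1)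
    (t : ↥(Subgroup.centralizer ({t₀} : Set (((cmDatum L 2 (Matrix.of fun i j : Fin 2 => if i.val + j.val + 1 = 2 then (1 : L) else 0)).Local v) × ((cmDatum L 1 (Matrix.of fun i j : Fin 1 => if i.val + j.val + 1 = 1 then (1 : L) else 0)).Local v))))) (hRt : Reg (t : (((cmDatum L 2 (Matrix.of fun i j : Fin 2 => if i.val + j.val + 1 = 2 then (1 : L) else 0)).Local v) × ((cmDatum L 1 (Matrix.of fun i j : Fin 1 => if i.val + j.val + 1 = 1 then (1 : L) else 0)).Local v)))) :
    ((finHeckeValue L v μ (((P⁻¹).val * ((t : (((cmDatum L 2 (Matrix.of fun i j : Fin 2 => if i.val + j.val + 1 = 2 then (1 : L) else 0)).Local v) × ((cmDatum L 1 (Matrix.of fun i j : Fin 1 => if i.val + j.val + 1 = 1 then (1 : L) else 0)).Local v))).1.val.val : Matrix (Fin 2) (Fin 2) (LocalRing L v)) * P.val) 0 0 - ((P⁻¹).val * ((t : (((cmDatum L 2 (Matrix.of fun i j : Fin 2 => if i.val + j.val + 1 = 2 then (1 : L) else 0)).Local v) × ((cmDatum L 1 (Matrix.of fun i j : Fin 1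 => if i.val + j.val + 1 = 1 then (1 : L) else 0)).Local v))).1.val.val : Matrix (Fin 2) (Fin 2) (LocalRing L v)) * P.val) 1 1))⁻¹ : ℂ) *
        ((Real.sqrt (∏ w' : PlacesOver L v, ‖(((P⁻¹).val * ((t : (((cmDatum L 2 (Matrix.of fun i j : Fin 2 => if i.val + j.val + 1 = 2 then (1 : L) else 0)).Local v) × ((cmDatum L 1 (Matrix.of fun i j : Fin 1 => if i.val + j.val + 1 = 1 then (1 : L) else 0)).Local v))).1.val.val : Matrix (Fin 2) (Fin 2) (LocalRing L v)) * P.val) 0 0 - ((P⁻¹).val * ((t : (((cmDatum L 2 (Matrix.of fun i j : Fin 2 => if i.val + j.val + 1 = 2 then (1 : L) else 0)).Local v) × ((cmDatum L 1 (Matrix.of fun i j : Fin 1 => if i.val + j.val + 1 = 1 then (1 : L) else 0)).Local v))).1.val.val : Matrix (Fin 2) (Fin 2) (LocalRing L v)) * P.val) 1 1) w'‖) : ℝ) : ℂ) *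
        (2 * classOrbitalIntegral m ({a : (((cmDatum L 2 (Matrix.of fun i j : Fin 2 => if i.val + j.val + 1 = 2 then (1 : L) else 0)).Local v) × ((cmDatum L 1 (Matrix.of fun i j : Fin 1 => if i.val + j.val + 1 = 1 then (1 : L) else 0)).Local v)) | ((localNonsplitEquiv (IsCMField.complexConj L) (Matrix.of fun i j : Fin 2 => if i.val + j.val + 1 = 2 then (1 : L) else 0) (IsCMField.complexConj_ne_one L) w hw a.1 : ↥(unitaryGroupOfForm (galAdicCompletionMap (L := L) (IsCMField.complexConj L) hw) (placeForm (Matrix.of fun i j : Fin 2 => if i.val + j.val + 1 = 2 then (1 : L) else 0) w.1))) : GL (Fin 2) (w.1.adicCompletion L)) ∈ S ∧ a.2 ∈ C}.indicator fun _ => (1 : ℂ)) (ConjClasses.mk (t : (((cmDatum L 2 (Matrix.of fun i j : Fin 2 => if i.val + j.val + 1 = 2 then (1 : L) else 0)).Local v) × ((cmDatum L 1 (Matrix.of fun i j : Fin 1 => if i.val + j.val + 1 = 1 then (1 : L) else 0)).Local v)))) -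
          ∑ᶠ c ∈ {c : ConjClasses (((cmDatum L 2 (Matrix.of fun i j : Fin 2 => if i.val + j.val + 1 = 2 then (1 : L) else 0)).Local v) × ((cmDatum L 1 (Matrix.of fun i j : Fin 1 => if i.val + j.val + 1 = 1 then (1 : L) else 0)).Local v)) | IsLocalStablyConjH L v (t : (((cmDatum L 2 (Matrix.of fun i j : Fin 2 => if i.val + j.val + 1 = 2 then (1 : L) else 0)).Local v) × ((cmDatum L 1 (Matrix.of fun i j : Fin 1 => if i.val + j.val + 1 = 1 then (1 : L) else 0)).Local v))) (Quotient.out c)},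
            classOrbitalIntegral m ({a : (((cmDatum L 2 (Matrix.of fun i j : Fin 2 => if i.val + j.val + 1 = 2 then (1 : L) else 0)).Local v) × ((cmDatum L 1 (Matrix.of fun i j : Fin 1 => if i.val + j.val + 1 = 1 then (1 : L) else 0)).Local v)) | ((localNonsplitEquiv (IsCMField.complexConj L) (Matrix.of fun i j : Fin 2 => if i.val + j.val + 1 = 2 then (1 : L) else 0) (IsCMField.complexConj_ne_one L) w hw a.1 : ↥(unitaryGroupOfForm (galAdicCompletionMap (L := L) (IsCMField.complexConj L) hw) (placeForm (Matrix.of fun i j : Fin 2 => if i.val + j.val + 1 = 2 then (1 : L) else 0) w.1))) : GL (Fin 2) (w.1.adicCompletion L)) ∈ S ∧ a.2 ∈ C}.indicator fun _ => (1 : ℂ)) c) = 0 := by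
  obtain ⟨r, hru, u, e, -, -, -, hAd, -, hest, -, hν, -, hvu, -, -, hEw, -, hSall⟩ :=
    exists_unitSimilitudePartner_onePlace_of_ramified L v w hw he t₀ P d ht₀ hP hd1
  have hfix := indicator_levelSet_comp_eq L v w hw e S C (hSall S (hS u hvu)) (fun a => (hAd a).2)
  rw [two_mul_classOrbitalIntegral_sub_finsum_eq_zero_of_comp_eq L v ν w hw hconj hstab hm e (hν ν) _ hfix t₀ P d ht₀ hP hd1 t (hReg _ hRt) hRt
    (hest t (hReg _ hRt)), mul_zero]

include hw he in
/-- **… in the `∃ fC` dress of the letter ★ `RankOneUnstableTransferNonsplitCMERamified` at one datum for `f = f_{S,C}`, `fC = 0`** (locally constant, compactly supported).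
[cite: LabesseLanglands1979, §2 pp. 9–10] [cite: Rogawski1990, §4.9 Lemma 4.9.3 (4.9.2) p. 56] -/
theorem exists_letter_levelIndicator_of_ramified (μ : HeckeCharacter L)
    {m : OrbitalMeasureFamily (((cmDatum L 2 (Matrix.of fun i j : Fin 2 => if i.val + j.val + 1 = 2 then (1 : L) else 0)).Local v) × ((cmDatum L 1 (Matrix.of fun i j : Fin 1 => if i.val + j.val + 1 = 1 then (1 : L) else 0)).Local v))} {Reg : (((cmDatum L 2 (Matrix.of fun i j : Fin 2 => if i.val + j.val + 1 = 2 then (1 : L) else 0)).Local v) × ((cmDatum L 1 (Matrix.of fun i j : Fin 1 => if i.val + j.val + 1 = 1 then (1 : L) else 0)).Local v)) → Prop} (hReg : ∀ γ, Reg γ → IsRegularElt (γ.1.val : GL (Fin 2) (LocalRing L v)))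
    (hconj : ∀ γ x, Reg γ → Reg (x * γ * x⁻¹)) (hstab : ∀ γ δ, Reg γ → IsLocalStablyConjH L v γ δ → Reg δ) (hm : m.IsCanonical Reg ν)
    (S : Subgroup (GL (Fin 2) (w.1.adicCompletion L)))
    (hS : ∀ x : (w.1.adicCompletion L)ˣ, Valued.v (x : w.1.adicCompletion L) = 1 →
      ∀ s, glDiagonal 2 (w.1.adicCompletion L) ![1, x] * s * (glDiagonal 2 (w.1.adicCompletion L) ![1, x])⁻¹ ∈ S ↔ s ∈ S)
    (C : Set ((cmDatum L 1 (Matrix.of fun i j : Fin 1 => if i.val + j.val + 1 = 1 then (1 : L) else 0)).Local v))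
    (t₀ : (((cmDatum L 2 (Matrix.of fun i j : Fin 2 => if i.val + j.val + 1 = 2 then (1 : L) else 0)).Local v) × ((cmDatum L 1 (Matrix.of fun i j : Fin 1 => if i.val + j.val + 1 = 1 then (1 : L) else 0)).Local v))) (P : GL (Fin 2) (LocalRing L v)) (d : Fin 2 → LocalRing L v) (ht₀ : IsRegularElt (t₀.1.val : GL (Fin 2) (LocalRing L v)))
    (hP : (t₀.1.val.val : Matrix (Fin 2) (Fin 2) (LocalRing L v)) * P.val = P.val * Matrix.diagonal d) (hd1 : ∀ i, (conjLocal L (IsCMField.complexConj L) v) (d i) * d i = 1) :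
    ∃ fC : ↥(Subgroup.centralizer ({t₀} : Set (((cmDatum L 2 (Matrix.of fun i j : Fin 2 => if i.val + j.val + 1 = 2 then (1 : L) else 0)).Local v) × ((cmDatum L 1 (Matrix.of fun i j : Fin 1 => if i.val + j.val + 1 = 1 then (1 : L) else 0)).Local v)))) → ℂ, IsLocallyConstant fC ∧ HasCompactSupport fC ∧
      ∀ t : ↥(Subgroup.centralizer ({t₀} : Set (((cmDatum L 2 (Matrix.of fun i j : Fin 2 => if i.val + j.val + 1 = 2 then (1 : L) else 0)).Local v) × ((cmDatum L 1 (Matrix.of fun i j : Fin 1 => if i.val + j.val + 1 = 1 then (1 : L) else 0)).Local v)))), Reg (t : (((cmDatum L 2 (Matrix.of fun i j : Fin 2 => if i.val + j.val + 1 = 2 then (1 : L) else 0)).Local v) × ((cmDatum L 1 (Matrix.of fun i j : Fin 1 => if i.val + j.val + 1 = 1 then (1 : L) else 0)).Local v))) →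
        ((finHeckeValue L v μ (((P⁻¹).val * ((t : (((cmDatum L 2 (Matrix.of fun i j : Fin 2 => if i.val + j.val + 1 = 2 then (1 : L) else 0)).Local v) × ((cmDatum L 1 (Matrix.of fun i j : Fin 1 => if i.val + j.val + 1 = 1 then (1 : L) else 0)).Local v))).1.val.val : Matrix (Fin 2) (Fin 2) (LocalRing L v)) * P.val) 0 0 - ((P⁻¹).val * ((t : (((cmDatum L 2 (Matrix.of fun i j : Fin 2 => if i.val + j.val + 1 = 2 then (1 : L) else 0)).Local v) × ((cmDatum L 1 (Matrix.of fun i j : Fin 1 => if i.val + j.val + 1 = 1 then (1 : L) else 0)).Local v))).1.val.val : Matrix (Fin 2) (Fin 2) (LocalRing L v)) * P.val) 1 1))⁻¹ : ℂ) *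
            ((Real.sqrt (∏ w' : PlacesOver L v, ‖(((P⁻¹).val * ((t : (((cmDatum L 2 (Matrix.of fun i j : Fin 2 => if i.val + j.val + 1 = 2 then (1 : L) else 0)).Local v) × ((cmDatum L 1 (Matrix.of fun i j : Fin 1 => if i.val + j.val + 1 = 1 then (1 : L) else 0)).Local v))).1.val.val : Matrix (Fin 2) (Fin 2) (LocalRing L v)) * P.val) 0 0 - ((P⁻¹).val * ((t : (((cmDatum L 2 (Matrix.of fun i j : Fin 2 => if i.val + j.val + 1 = 2 then (1 : L) else 0)).Local v) × ((cmDatum L 1 (Matrix.of fun i j : Fin 1 => if i.val + j.val + 1 = 1 then (1 : L) else 0)).Local v))).1.val.val : Matrix (Fin 2) (Fin 2) (LocalRing L v)) * P.val) 1 1) w'‖) : ℝ) : ℂ) *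
            (2 * classOrbitalIntegral m ({a : (((cmDatum L 2 (Matrix.of fun i j : Fin 2 => if i.val + j.val + 1 = 2 then (1 : L) else 0)).Local v) × ((cmDatum L 1 (Matrix.of fun i j : Fin 1 => if i.val + j.val + 1 = 1 then (1 : L) else 0)).Local v)) | ((localNonsplitEquiv (IsCMField.complexConj L) (Matrix.of fun i j : Fin 2 => if i.val + j.val + 1 = 2 then (1 : L) else 0) (IsCMField.complexConj_ne_one L) w hw a.1 : ↥(unitaryGroupOfForm (galAdicCompletionMap (L := L) (IsCMField.complexConj L) hw) (placeForm (Matrix.of fun i j : Fin 2 => if i.val + j.val + 1 = 2 then (1 : L) else 0) w.1))) : GL (Fin 2) (w.1.adicCompletion L)) ∈ S ∧ a.2 ∈ C}.indicator fun _ => (1 : ℂ)) (ConjClasses.mk (t : (((cmDatum L 2 (Matrix.of fun i j : Fin 2 => if i.val + j.val + 1 = 2 then (1 : L) else 0)).Local v) × ((cmDatum L 1 (Matrix.of fun i j : Fin 1 => if i.val + j.val + 1 = 1 then (1 : L) else 0)).Local v)))) -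
              ∑ᶠ c ∈ {c : ConjClasses (((cmDatum L 2 (Matrix.of fun i j : Fin 2 => if i.val + j.val + 1 = 2 then (1 : L) else 0)).Local v) × ((cmDatum L 1 (Matrix.of fun i j : Fin 1 => if i.val + j.val + 1 = 1 then (1 : L) else 0)).Local v)) | IsLocalStablyConjH L v (t : (((cmDatum L 2 (Matrix.of fun i j : Fin 2 => if i.val + j.val + 1 = 2 then (1 : L) else 0)).Local v) × ((cmDatum L 1 (Matrix.of fun i j : Fin 1 => if i.val + j.val + 1 = 1 then (1 : L) else 0)).Local v))) (Quotient.out c)},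
                classOrbitalIntegral m ({a : (((cmDatum L 2 (Matrix.of fun i j : Fin 2 => if i.val + j.val + 1 = 2 then (1 : L) else 0)).Local v) × ((cmDatum L 1 (Matrix.of fun i j : Fin 1 => if i.val + j.val + 1 = 1 then (1 : L) else 0)).Local v)) | ((localNonsplitEquiv (IsCMField.complexConj L) (Matrix.of fun i j : Fin 2 => if i.val + j.val + 1 = 2 then (1 : L) else 0) (IsCMField.complexConj_ne_one L) w hw a.1 : ↥(unitaryGroupOfForm (galAdicCompletionMap (L := L) (IsCMField.complexConj L) hw) (placeForm (Matrix.of fun i j : Fin 2 => if i.val + j.val + 1 = 2 then (1 : L) else 0) w.1))) : GL (Fin 2) (w.1.adicCompletion L)) ∈ S ∧ a.2 ∈ C}.indicator fun _ => (1 : ℂ)) c) = fC t :=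
  ⟨0, IsLocallyConstant.const 0, HasCompactSupport.zero, fun t hRt =>
    rankOne_letter_lhs_levelIndicator_eq_zero_of_ramified L v w hw he ν μ hReg hconj hstab hm S hS C t₀ P d ht₀ hP hd1 t hRt⟩

end Letter

/-! ## §4 The `S`-hypothesis for the named levels: `GL₂(𝒪_w)`, the valued congruence subgroups `K(m)`, and their `D_η`-conjugates (`K♯`, …) -/

section Levels

variable (L : Type) [Field L] [NumberField L] [IsCMField L] (v : HeightOneSpectrum (𝓞 ↥(maximalRealSubfield L))) (w : PlacesOver L v)

omit [IsCMField L] in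
/-- **`K = GL₂(𝒪_w)`** is normalised by every `diag(1, x)`, `x ∈ 𝒪_wˣ` (★ `conj_glDiagonal_one_unit_mem_glInt_iff`) — the `hS` of §2∕§3 for the edge stabiliser.
[cite: Rogawski1990, §12.6 p. 174] [cite: Serre1980Trees, Ch. II §1.2] -/
theorem forall_conj_glDiagonal_one_unit_mem_glInt_iff :
    ∀ x : (w.1.adicCompletion L)ˣ, Valued.v (x : w.1.adicCompletion L) = 1 →
      ∀ s, glDiagonal 2 (w.1.adicCompletion L) ![1, x] * s * (glDiagonal 2 (w.1.adicCompletion L) ![1, x])⁻¹ ∈ glInt 2 (w.1.adicCompletion L) ↔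
        s ∈ glInt 2 (w.1.adicCompletion L) :=
  fun x hx s => conj_glDiagonal_one_unit_mem_glInt_iff L v w x hx s

omit [IsCMField L] in
/-- **`K(m)`** — every valued congruence subgroup `{k : ‖k − 1‖ ≤ c}` of `GL₂(L_w)` is normalised by every `diag(1, x)`, `x ∈ 𝒪_wˣ` (★ `conj_glDiagonal_one_unit_mem_valuedCongruenceSubgroup_iff`).
[cite: BushnellHenniart2006, §1.1] [cite: Rogawski1990, §12.6 p. 174] -/
theorem forall_conj_glDiagonal_one_unit_mem_valuedCongruenceSubgroup_iff (c : WithZero (Multiplicative ℤ)) :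
    ∀ x : (w.1.adicCompletion L)ˣ, Valued.v (x : w.1.adicCompletion L) = 1 →
      ∀ s, glDiagonal 2 (w.1.adicCompletion L) ![1, x] * s * (glDiagonal 2 (w.1.adicCompletion L) ![1, x])⁻¹ ∈ valuedCongruenceSubgroup (Fin 2) c ↔
        s ∈ valuedCongruenceSubgroup (Fin 2) c :=
  fun x hx s => conj_glDiagonal_one_unit_mem_valuedCongruenceSubgroup_iff x hx c s

omit [IsCMField L] in
/-- **`D_η S D_η⁻¹`** (the vertex stabiliser `K♯ = D_η GL₂(𝒪_w) D_η⁻¹`, `D_η K(m) D_η⁻¹`, …): if `S` is normalised by every `diag(1, x)`, `x ∈ 𝒪_wˣ`, so is its conjugate by ANY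
diagonal `D` (diagonal matrices commute; ★ `conj_glDiagonal_mem_map_conj_glDiagonal_iff`). [cite: Rogawski1990, §12.6 p. 174] [cite: Kottwitz1988, §2] -/
theorem forall_conj_glDiagonal_one_unit_mem_map_conj_glDiagonal_iff {S : Subgroup (GL (Fin 2) (w.1.adicCompletion L))}
    (hS : ∀ x : (w.1.adicCompletion L)ˣ, Valued.v (x : w.1.adicCompletion L) = 1 →
      ∀ s, glDiagonal 2 (w.1.adicCompletion L) ![1, x] * s * (glDiagonal 2 (w.1.adicCompletion L) ![1, x])⁻¹ ∈ S ↔ s ∈ S)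
    (d' : Fin 2 → (w.1.adicCompletion L)ˣ) :
    ∀ x : (w.1.adicCompletion L)ˣ, Valued.v (x : w.1.adicCompletion L) = 1 →
      ∀ s, glDiagonal 2 (w.1.adicCompletion L) ![1, x] * s * (glDiagonal 2 (w.1.adicCompletion L) ![1, x])⁻¹ ∈
          S.map (MulAut.conj (glDiagonal 2 (w.1.adicCompletion L) d')).toMonoidHom ↔
        s ∈ S.map (MulAut.conj (glDiagonal 2 (w.1.adicCompletion L) d')).toMonoidHom :=
  fun x hx s => conj_glDiagonal_mem_map_conj_glDiagonal_iff ![1, x] (hS x hx) d' s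

end Levels

end Literature.NumberTheory.Rogawski1990

end
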